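import Summits.QuantumFields.YangMills.Theorems.ParabolicTrajectoryBalabanStepParabolicStubParabolicBlock
import Summits.QuantumFields.YangMills.Theorems.ParabolicTrajectoryBalabanStepParabolicStubRealisation
import Summits.QuantumFields.YangMills.Theorems.BalabanStepParabolic.Negative.EvenRedundant
import Summits.QuantumFields.YangMills.Theses.ParabolicTrajectory
import HarnessLib

/-!
# Crux `BalabanStepParabolic` — the regulator-chart bridge: `RegulatorChart G r M` inhabits `BalabanBanachStep G r M`

Support file for crux `stmt-QuantumFields-9684`
(`Summit.QuantumFields.YangMills.Theses.ParabolicTrajectory.BalabanStepParabolic`), line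
`perfect-action-regulator-chart` (lead `prover-line-stmt-QuantumFields-9684-0`, skeleton
`Cruxes/BalabanStepParabolic/Lines/perfect-action-regulator-chart.lean` v4).

`nonempty_balabanBanachStep_of_regulatorChart`: for EVERY gauge group `G`, lattice representation `r` and block
factor `M`, an inhabitant of the Literature hypothesis structure `RegulatorChart G r M` (the perfect-action regulator
chart: `C¹` half-chart normal form `SmoothHalfChart`, Wilson arc, bare-coupling dictionary, curvature chart functions
with inside-chart covariance / arc identification / chart continuity) yields an inhabitant of the crux structure
`BalabanBanachStep G r M`. It is the composition of the two LANDED stubs of the line — `stub_parabolicBlock`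
(smooth half-chart ⇒ verbatim Lipschitz block for the odd/even extension) and `stub_realisation` (parabolic block +
basin block + chart realisation data ⇒ the structure, by injectivising the step on `E × (ℝ × E)` and killing
non-curvature species) — threaded through `ChartRealisationData.congr`. Consequently the crux for `(G, r)` follows
from `∃ M₀, ∀ M ≥ M₀, Nonempty (RegulatorChart G r M)` (`forall_nonempty_balabanBanachStep_of_regulatorChart`, pointwise in
`(G, r)`; no compactness/simplicity hypothesis is used by the bridge), which is the line's load-bearing registered stub
(`stub_regulatorChart`; its odd-`M` restriction after the parity reshape, glue `balabanStepParabolic_of_regulatorChartOdd`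
with `Negative.nonempty_of_even` for even `M`) — crux-sized: by `Negative/OrbitTransport.lean` its field `corr_continuousOn` at
accumulation points of Wilson orbits is a continuum-type limit of genuine block-dilated Wilson plaquette
correlators along the inhabitant's tuning.
-/

open scoped SchwartzMap
open MeasureTheory Filter Topology
open Literature.MathematicalPhysics.AQFT Literature.MathematicalPhysics.QuantumLattice
open Literature.Probability.LatticeModels
open Literature.MathematicalPhysics.QuantumFieldTheory

noncomputable section

namespace Summit.QuantumFields.YangMills.Theorems.BalabanStepParabolic

variable {G : Type} [Group G] [TopologicalSpace G] [IsTopologicalGroup G] [CompactSpace G]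
  [MeasurableSpace G] [BorelSpace G] {r : LatticeRep G} {M : ℕ}

/-- **The regulator-chart bridge, from one chart.** A perfect-action regulator chart `𝒞 : RegulatorChart G r M`
inhabits `BalabanBanachStep G r M`: extend the smooth half-chart maps `(𝒞.φ, 𝒞.Ψ)` by `stub_parabolicBlock` to
maps `(φ', Ψ')` on `|g| ≤ δ` carrying the verbatim Lipschitz and basin blocks, transport the realisation data
along the agreement on `g ≥ 0`, and apply `stub_realisation`. [folklore] -/
theorem nonempty_balabanBanachStep_of_regulatorChart (𝒞 : RegulatorChart G r M) :
    Nonempty (BalabanBanachStep G r M) := by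
  have hs := 𝒞.smooth
  obtain ⟨φ', Ψ', C', hC', hagree, hPB, hBB⟩ :=
    stub_parabolicBlock 𝒞.E 𝒞.φ 𝒞.Ψ 𝒞.A 𝒞.φg 𝒞.φy 𝒞.Ψg 𝒞.Ψy (𝒞.b₀ * Real.log M) 𝒞.C 𝒞.δ 𝒞.R 𝒞.θ' hs
  exact stub_realisation G r M 𝒞.E φ' Ψ' 𝒞.A 𝒞.b₀ 𝒞.θ C' 𝒞.δ 𝒞.R 𝒞.θ' 𝒞.two_le_M 𝒞.b₀_pos 𝒞.θ_nonneg
    𝒞.θ_lt_one 𝒞.norm_A_le hC' hs.δ_pos hs.δ_le_R hs.θ'_nonneg 𝒞.θ'_lt_one hPB hBB 𝒞.yW 𝒞.g₀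
    𝒞.betaOf 𝒞.κ 𝒞.K 𝒞.corr (𝒞.realisation.congr hagree)

/-- **The regulator-chart bridge** (registered sub-goal `regulatorChart_bridge` of the crux item): for every
`(G, r, M)`, `Nonempty (RegulatorChart G r M) → Nonempty (BalabanBanachStep G r M)`. [folklore] -/
theorem regulatorChart_bridge :
    ∀ (G : Type) [Group G] [TopologicalSpace G] [IsTopologicalGroup G] [CompactSpace G]
      [MeasurableSpace G] [BorelSpace G]
      (r : Literature.MathematicalPhysics.QuantumFieldTheory.LatticeRep G) (M : ℕ),
      Nonempty (Literature.MathematicalPhysics.QuantumFieldTheory.RegulatorChart G r M) →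
        Nonempty (Literature.MathematicalPhysics.QuantumFieldTheory.BalabanBanachStep G r M) :=
  fun _G _ _ _ _ _ _ _r _M ⟨𝒞⟩ => nonempty_balabanBanachStep_of_regulatorChart 𝒞

/-- **The crux for `(G, r)` from regulator charts for `(G, r)`**: if `RegulatorChart G r M` is inhabited for all
`M ≥ M₀`, then `BalabanBanachStep G r M` is inhabited for all `M ≥ M₀` — the exact shape of the crux's conclusion,
pointwise in the gauge group and the representation. [folklore] -/
theorem forall_nonempty_balabanBanachStep_of_regulatorChart (r : LatticeRep G)
    (h : ∃ M₀ : ℕ, ∀ M : ℕ, M₀ ≤ M → Nonempty (RegulatorChart G r M)) :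
    ∃ M₀ : ℕ, ∀ M : ℕ, M₀ ≤ M → Nonempty (BalabanBanachStep G r M) := by
  obtain ⟨M₀, hM₀⟩ := h
  exact ⟨M₀, fun M hM => (hM₀ M hM).elim fun 𝒞 => nonempty_balabanBanachStep_of_regulatorChart 𝒞⟩

/-- **Glue for the promoted statement.** If, for every compact simple Lie `G` and lattice representation `r`,
the perfect-action regulator chart is inhabited for all large ODD block factors, then the crux
`BalabanStepParabolic` holds: `M₀' = max M₀ 2`, even `M` by the disprover's thin chart
(`Negative.nonempty_of_even`, zero renormalisation-group content), odd `M` by the bridge. This is the assembly a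
planner needs when `∀ G r, ∃ M₀, ∀ M ≥ M₀, Odd M → Nonempty (RegulatorChart G r M)` is filed as an item (the
hypothesis is stated in full; nothing is asserted about it here). [folklore] -/
theorem balabanStepParabolic_of_regulatorChartOdd
    (h : ∀ (G : Type) [Group G] [TopologicalSpace G] [IsTopologicalGroup G] [CompactSpace G],
      IsCompactSimpleLieGroup G →
      letI : MeasurableSpace G := borel G
      haveI : BorelSpace G := ⟨rfl⟩
      ∀ (r : LatticeRep G), ∃ M₀ : ℕ, ∀ M : ℕ, M₀ ≤ M → Odd M → Nonempty (RegulatorChart G r M)) :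
    Summit.QuantumFields.YangMills.Theses.ParabolicTrajectory.BalabanStepParabolic := by
  intro G _ _ _ _ hG
  letI : MeasurableSpace G := borel G
  haveI : BorelSpace G := ⟨rfl⟩
  intro r
  obtain ⟨M₀, hM₀⟩ := h G hG r
  refine ⟨max M₀ 2, fun M hM => ?_⟩
  have h2 : 2 ≤ M := (le_max_right _ _).trans hM
  rcases Nat.even_or_odd M with he | ho
  · exact Negative.nonempty_of_even r M h2 he
  · exact (hM₀ M ((le_max_left _ _).trans hM) ho).elim fun 𝒞 => nonempty_balabanBanachStep_of_regulatorChart 𝒞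

/-- **Glue, all block factors.** The same from regulator charts for all large `M` (the line's original
load-bearing stub `stub_regulatorChart`). [folklore] -/
theorem balabanStepParabolic_of_regulatorChartAll
    (h : ∀ (G : Type) [Group G] [TopologicalSpace G] [IsTopologicalGroup G] [CompactSpace G],
      IsCompactSimpleLieGroup G →
      letI : MeasurableSpace G := borel G
      haveI : BorelSpace G := ⟨rfl⟩
      ∀ (r : LatticeRep G), ∃ M₀ : ℕ, ∀ M : ℕ, M₀ ≤ M → Nonempty (RegulatorChart G r M)) :
    Summit.QuantumFields.YangMills.Theses.ParabolicTrajectory.BalabanStepParabolic :=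
  balabanStepParabolic_of_regulatorChartOdd fun G _ _ _ _ hG r => by
    obtain ⟨M₀, hM₀⟩ := h G hG r
    exact ⟨M₀, fun M hM _ => hM₀ M hM⟩

end Summit.QuantumFields.YangMills.Theorems.BalabanStepParabolic

end
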